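import Summits.Langlands.Langlands.Theses.FaltingsSerreTransfer
import Literature.NumberTheory.GaloisRepresentations.ArtinRestriction
import Literature.NumberTheory.GaloisRepresentations.LocalGlobalCohomologyProofs
import Literature.LinearAlgebra.Matrix.TracePowersDetermineCharpoly

/-!
# `FaltingsSerreTransfer.FaltingsSerreCriterion` — proved outright

Route `Summits/Langlands/Langlands/Theses/FaltingsSerreTransfer` (item `stmt-Langlands-28081`,
support, rank 9; the binder `hFS` of the route's deciding theorem `closes`):
**the Faltings–Serre criterion in its typed, ineffective form.**  For two continuous
`ρ₁, ρ₂ : Γ_K → GL_n(ℚ̄_ℓ)` there are a bound `B` and a finite set `S` of places such that, for every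
set `T` of finite places whose Frobenius classes meet every conjugacy class of every finite quotient
`φ : Γ_K → H`, `#H ≤ B`, with open kernel and unramified outside `S` (the "Chebotarev clause"),
agreement of the Frobenius characteristic polynomials of `ρ₁, ρ₂` on `T` forces
`det(X - ρ₁(σ)) = det(X - ρ₂(σ))` for EVERY `σ ∈ Γ_K`.

## Proof (uniform-continuity deviation group; no lattices, no Baire, no residual reduction)

Because the typed statement lets `B` and `S` depend on `(ρ₁, ρ₂)` and asks only for their
EXISTENCE, the classical deviation group `δ(Γ_K) ⊂ (M_n(𝒪_E) ⊕ M_n(𝒪_E))/𝔪` of Faltings–Serre can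
be replaced by a purely topological one.  Let `t = tr ρ₁ - tr ρ₂ : Γ_K → ℚ̄_ℓ` (continuous, a class
function).

* If `t ≡ 0`, Newton's identities in characteristic `0`
  (`Matrix.charpoly_eq_charpoly_of_trace_pow_eq`, applied to `tr ρᵢ(σ)^m = tr ρᵢ(σ^m)`) give
  `det(X - ρ₁ σ) = det(X - ρ₂ σ)` for all `σ`; take `B = 0`, `S = ∅`.
* Otherwise let `c = max_{Γ_K} ‖t‖ > 0` (compactness), attained at `g₀`.  The set
  `N = {g | ∀ a b, ‖t(agb) - t(ab)‖ < c}` is a NORMAL SUBGROUP (ultrametric inequality) which is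
  OPEN (uniform continuity of `t` on the compact group `Γ_K × Γ_K × Γ_K`, via the generalized tube
  lemma) — `exists_normal_isOpen_forall_norm_sub_lt`.  Hence `Γ_K/N` is finite; put
  `B = #(Γ_K/N)` and `S =` the finitely many places at which some inertia group is not inside `N`
  (`eventually_forall_inertia_mem_of_isOpen`: the places dividing the different of `K̄^N / K`).
  Given `T` as in the statement, apply the Chebotarev clause to `φ : Γ_K → Γ_K/N` and `g₀`: some
  Frobenius `σ₀` at a place `v ∈ T` has `φ(σ₀)` conjugate to `φ(g₀)`, i.e. `g₀ ∈ h σ₀ h⁻¹ · N`.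
  By agreement of the Frobenius polynomials at `v` (at every arithmetic Frobenius, by the typed
  `HasFrobCharpolyAt`), `t(σ₀) = 0`, so `t(h σ₀ h⁻¹) = 0` and the defining property of `N` gives
  `‖t(g₀)‖ = ‖t(g₀) - t(hσ₀h⁻¹)‖ < c = ‖t(g₀)‖`, a contradiction: no such `T` exists unless
  `t ≡ 0`, and the conclusion holds.

References: G. Faltings, *Endlichkeitssätze für abelsche Varietäten über Zahlkörpern*, Invent.
Math. 73 (1983), §5 (proof of Satz 5) [Faltings1983]; J.-P. Serre, *Résumé des cours de 1984–1985*,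
Annuaire du Collège de France (1985) (the "quartic fields" method) [Serre1985Resume]; R. Livné,
*Cubic exponential sums and Galois representations*, Contemp. Math. 67 (1987), §4 [Livne1987];
G. Chênevert, *Exponential sums, hypersurfaces with many symmetries and Galois representations*,
PhD thesis, McGill (2008), Ch. 4–5 (the deviation group).  The ineffective form
proved here is the one the route `FaltingsSerreTransfer` consumes (its `closes` feeds `B, S` to
the Chebotarev supply `ChebotarevFiniteSupply`).

No `sorry`, no new axioms; every input is a theorem of the tree or of Mathlib.
-/

open Literature.NumberTheory.GaloisRepresentations Field NumberField IsDedekindDomain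
open Filter Topology

set_option linter.dupNamespace false -- project-wide option; `Summit.Langlands.Langlands` is the mandated namespace
set_option autoImplicit false

namespace Summit.Langlands.Langlands.Theorems

/-! ### 1. Inertia groups at almost all places lie in a given open normal subgroup -/

/-- For an open normal subgroup `N ≤ Γ_F` of the absolute Galois group of a number field, all but
finitely many finite places `v` of `F` have every inertia group `I_𝔓`, `𝔓 ∣ v`, inside `N`
(the places not dividing the different of the finite Galois extension `F̄^N / F`).
Immediate from the tree's `eventually_forall_inertia_mem_fixingSubgroup` and Krull's
correspondence `Gal(F̄/F̄^N) = N` (`fixingSubgroup_fixedField_of_isOpen`). [folklore] -/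
theorem eventually_forall_inertia_mem_of_isOpen {F : Type*} [Field F] [NumberField F]
    (N : Subgroup (absoluteGaloisGroup F)) [hN : N.Normal]
    (hNo : IsOpen (N : Set (absoluteGaloisGroup F))) :
    ∀ᶠ v : HeightOneSpectrum (𝓞 F) in Filter.cofinite, ∀ 𝔓 ∈ v.primesAbove,
      ∀ g ∈ 𝔓.inertia (absoluteGaloisGroup F), g ∈ N := by
  haveI : FiniteDimensional F (IntermediateField.fixedField N :
      IntermediateField F (AlgebraicClosure F)) := finiteDimensional_fixedField_of_isOpen N hNo
  have hLN := fixingSubgroup_fixedField_of_isOpen N hNo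
  haveI : IsGalois F (IntermediateField.fixedField N :
      IntermediateField F (AlgebraicClosure F)) := by
    rw [← InfiniteGalois.normal_iff_isGalois, hLN]; exact hN
  have h := eventually_forall_inertia_mem_fixingSubgroup
    (IntermediateField.fixedField N : IntermediateField F (AlgebraicClosure F))
  rw [hLN] at h
  exact h

/-! ### 2. The uniform-continuity deviation subgroup -/

/-- **Deviation subgroup.**  Let `Γ` be a compact topological group, `τ : Γ → C` a continuous map
to an ultrametric seminormed group and `c > 0`.  Then there is an OPEN NORMAL subgroup `N ≤ Γ`
such that `‖τ(a g) - τ(a)‖ < c` for all `g ∈ N`, `a ∈ Γ`; namely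
`N = {g | ∀ a b, ‖τ(a g b) - τ(a b)‖ < c}` — a subgroup by the ultrametric inequality, normal by
construction, and open by uniform continuity of `(a, b, g) ↦ τ(a g b) - τ(a b)` on the compact
space `(Γ × Γ) × Γ` (generalized tube lemma). [folklore] -/
theorem exists_normal_isOpen_forall_norm_sub_lt {Γ : Type*} [Group Γ] [TopologicalSpace Γ]
    [IsTopologicalGroup Γ] [CompactSpace Γ] {C : Type*} [SeminormedAddCommGroup C]
    [IsUltrametricDist C] {τ : Γ → C} (hτ : Continuous τ) {c : ℝ} (hc : 0 < c) :
    ∃ N : Subgroup Γ, N.Normal ∧ IsOpen (N : Set Γ) ∧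
      ∀ g ∈ N, ∀ a : Γ, ‖τ (a * g) - τ a‖ < c := by
  let N : Subgroup Γ :=
    { carrier := {g | ∀ a b : Γ, ‖τ (a * g * b) - τ (a * b)‖ < c}
      one_mem' := by
        intro a b
        simp [hc]
      mul_mem' := by
        intro g g' hg hg'
        simp only [Set.mem_setOf_eq] at hg hg' ⊢
        intro a b
        have h1 : ‖τ (a * g * (g' * b)) - τ (a * (g' * b))‖ < c := hg a (g' * b)
        have h2 : ‖τ (a * g' * b) - τ (a * b)‖ < c := hg' a b
        have e : τ (a * (g * g') * b) - τ (a * b) =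
            (τ (a * g * (g' * b)) - τ (a * (g' * b))) + (τ (a * g' * b) - τ (a * b)) := by
          simp only [mul_assoc, sub_add_sub_cancel]
        rw [e]
        exact (IsUltrametricDist.norm_add_le_max _ _).trans_lt (max_lt h1 h2)
      inv_mem' := by
        intro g hg
        simp only [Set.mem_setOf_eq] at hg ⊢
        intro a b
        have h := hg (a * g⁻¹) b
        rw [inv_mul_cancel_right] at h
        rwa [norm_sub_rev] }
  have hmem : ∀ g : Γ, g ∈ N ↔ ∀ a b : Γ, ‖τ (a * g * b) - τ (a * b)‖ < c := fun _ => Iff.rfl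
  have hNn : N.Normal := ⟨fun g hg h => by
    rw [hmem] at hg ⊢
    intro a b
    have h1 := hg (a * h) (h⁻¹ * b)
    simpa only [mul_assoc, mul_inv_cancel_left] using h1⟩
  have hNo : IsOpen (N : Set Γ) := by
    rw [isOpen_iff_mem_nhds]
    intro g hg
    replace hg : ∀ a b : Γ, ‖τ (a * g * b) - τ (a * b)‖ < c := (hmem g).1 hg
    have hM : IsOpen {p : (Γ × Γ) × Γ | ‖τ (p.1.1 * p.2 * p.1.2) - τ (p.1.1 * p.1.2)‖ < c} :=
      isOpen_lt (by fun_prop) continuous_const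
    have hsub : (Set.univ : Set (Γ × Γ)) ×ˢ ({g} : Set Γ) ⊆
        {p : (Γ × Γ) × Γ | ‖τ (p.1.1 * p.2 * p.1.2) - τ (p.1.1 * p.1.2)‖ < c} := by
      rintro ⟨⟨a, b⟩, g'⟩ hp
      simp only [Set.mem_prod, Set.mem_univ, Set.mem_singleton_iff, true_and] at hp
      subst hp
      exact hg a b
    obtain ⟨u, w, -, hw, hsu, hgw, huw⟩ :=
      generalized_tube_lemma isCompact_univ isCompact_singleton hM hsub
    refine Filter.mem_of_superset (hw.mem_nhds (hgw (Set.mem_singleton g))) fun g' hg' => ?_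
    rw [SetLike.mem_coe, hmem]
    intro a b
    exact huw (Set.mk_mem_prod (hsu (Set.mem_univ (a, b))) hg')
  refine ⟨N, hNn, hNo, fun g hg a => ?_⟩
  simpa using (hmem g).1 hg a 1

/-! ### 3. The criterion -/

/-- **The Faltings–Serre criterion (typed, ineffective form)** — proof of the route item
`FaltingsSerreTransfer.FaltingsSerreCriterion` (`stmt-Langlands-28081`).  See the module
docstring for the argument (deviation subgroup `N` of `t = tr ρ₁ - tr ρ₂` at level
`c = max ‖t‖`; `B = #(Γ_K/N)`, `S =` places with an inertia group not inside `N`; the Chebotarev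
clause at `φ : Γ_K → Γ_K/N`, `g₀ = argmax ‖t‖` produces a Frobenius `σ₀` with
`g₀ ∈ hσ₀h⁻¹N` and `t(σ₀) = 0`, contradiction; the case `t ≡ 0` is Newton's identities).
[cite: Faltings1983, §5] [cite: Livne1987, §4] -/
theorem faltingsSerreCriterion_proof :
    Summit.Langlands.Langlands.Theses.FaltingsSerreTransfer.FaltingsSerreCriterion := by
  intro K _ _ ℓ _ n ρ₁ ρ₂
  classical
  -- the trace difference, a continuous class function on the compact group `Γ_K`
  set τ : absoluteGaloisGroup K → PadicAlgCl ℓ :=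
    fun g => FramedRep.trace ρ₁ g - FramedRep.trace ρ₂ g with hτdef
  have hτ : Continuous τ :=
    (FramedRep.continuous_trace ρ₁).sub (FramedRep.continuous_trace ρ₂)
  have hconj : ∀ (ρ : FramedGaloisRep K (PadicAlgCl ℓ) n) (h g : absoluteGaloisGroup K),
      FramedRep.trace ρ (h * g * h⁻¹) = FramedRep.trace ρ g := by
    intro ρ h g
    simp only [FramedRep.trace, map_mul, map_inv, Units.val_mul, Matrix.trace_units_conj]
  by_cases h0 : ∀ g, τ g = 0
  · -- Case 1: equal traces everywhere — `B = 0`, `S = ∅`, Newton's identities.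
    refine ⟨0, ∅, Set.finite_empty, fun T _ _ σ => ?_⟩
    have htr : ∀ g, FramedRep.trace ρ₁ g = FramedRep.trace ρ₂ g :=
      fun g => sub_eq_zero.1 (h0 g)
    unfold FramedRep.charpoly
    refine Matrix.charpoly_eq_charpoly_of_trace_pow_eq _ _ rfl fun m _ _ => ?_
    rw [← Units.val_pow_eq_pow_val, ← Units.val_pow_eq_pow_val, ← map_pow, ← map_pow]
    exact htr (σ ^ m)
  · -- Case 2: `t` is not identically zero — the deviation subgroup at level `max ‖t‖`.
    push Not at h0
    obtain ⟨g₁, hg₁⟩ := h0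
    obtain ⟨g₀, -, hg₀⟩ := isCompact_univ.exists_isMaxOn Set.univ_nonempty
      (continuous_norm.comp hτ).continuousOn
    have hmax : ∀ g, ‖τ g‖ ≤ ‖τ g₀‖ := isMaxOn_univ_iff.1 hg₀
    have hc : 0 < ‖τ g₀‖ := (norm_pos_iff.2 hg₁).trans_le (hmax g₁)
    obtain ⟨N, hNn, hNo, hNt⟩ := exists_normal_isOpen_forall_norm_sub_lt hτ hc
    haveI : Finite (absoluteGaloisGroup K ⧸ N) := Subgroup.quotient_finite_of_isOpen N hNo
    have hS := eventually_forall_inertia_mem_of_isOpen N hNo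
    rw [Filter.eventually_cofinite] at hS
    refine ⟨Nat.card (absoluteGaloisGroup K ⧸ N), _, hS, fun T hT hP σ => ?_⟩
    exfalso
    -- the Chebotarev clause for `φ : Γ_K → Γ_K / N` (order `B`, open kernel `N`, unramified
    -- outside `S`) at `g₀`
    obtain ⟨v, hvT, 𝔓, h𝔓, σ₀, hσ₀, hcj⟩ := hT (absoluteGaloisGroup K ⧸ N) le_rfl
      (QuotientGroup.mk' N) (by rwa [QuotientGroup.ker_mk'])
      (fun v hv 𝔓 h𝔓 σ hσ => by
        simp only [Set.mem_setOf_eq, not_not] at hv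
        rw [QuotientGroup.mk'_apply, QuotientGroup.eq_one_iff]
        exact hv 𝔓 h𝔓 σ hσ)
      g₀
    -- the Frobenius characteristic polynomials, hence the traces, agree at `σ₀`
    obtain ⟨P, hP₁, hP₂⟩ := hP v hvT
    have hcp : FramedRep.charpoly ρ₁ σ₀ = FramedRep.charpoly ρ₂ σ₀ :=
      (hP₁ 𝔓 h𝔓 σ₀ hσ₀).trans (hP₂ 𝔓 h𝔓 σ₀ hσ₀).symm
    have hn : Nonempty (Fin n) := by
      rcases Nat.eq_zero_or_pos n with hn0 | hnp
      · exfalso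
        have : IsEmpty (Fin n) := ⟨fun i => Nat.not_succ_le_zero i.1 (hn0 ▸ i.2)⟩
        apply hg₁
        simp [hτdef, FramedRep.trace, Matrix.trace]
      · exact ⟨⟨0, hnp⟩⟩
    have hτσ₀ : τ σ₀ = 0 := by
      simp only [hτdef, sub_eq_zero, FramedRep.trace]
      rw [Matrix.trace_eq_neg_charpoly_coeff, Matrix.trace_eq_neg_charpoly_coeff]
      unfold FramedRep.charpoly at hcp
      rw [hcp]
    -- `g₀ ∈ h σ₀ h⁻¹ · N`
    obtain ⟨y, hy⟩ := isConj_iff.1 hcj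
    obtain ⟨h, rfl⟩ := QuotientGroup.mk'_surjective N y
    rw [← map_inv, ← map_mul, ← map_mul, QuotientGroup.mk'_eq_mk'] at hy
    obtain ⟨z, hz, hzg⟩ := hy
    have h1 := hNt z hz (h * σ₀ * h⁻¹)
    rw [hzg] at h1
    have h2 : τ (h * σ₀ * h⁻¹) = τ σ₀ := by
      simp only [hτdef, hconj]
    rw [h2, hτσ₀, sub_zero] at h1
    exact lt_irrefl _ h1

end Summit.Langlands.Langlands.Theorems
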